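import Mathlib
import Literature.Computability.Complexity.Space
import Literature.Computability.Complexity.PNPWave0
import Literature.Computability.Complexity.ProbabilisticClasses
import HarnessLib

/-!
# Catalytic space: the class `CL` (Buhrman–Cleve–Koucký–Loff–Speelman 2014)

H. Buhrman, R. Cleve, M. Koucký, B. Loff, F. Speelman, *Computing with a full memory: catalytic
space*, STOC 2014, pp. 857–866, doi:10.1145/2591796.2591874 = ECCC TR14-053
[`BuhrmanEtAl2014`]: "a catalytic-space computation … has a small amount of
clean space available and is equipped with additional auxiliary space, with the caveat that the
additional space is initially in an arbitrary, possibly incompressible, state and must be returned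
to this state when the computation is finished" (abstract).  `CL` = catalytic logspace =
`CSPACE(O(log n), n^{O(1)})`.  Printed state of the art (Alekseev–Filmus–Mertz–Smal–Vinciguerra,
arXiv:2504.17412, p. 2): "[BCK+14] showed `TC¹ ⊆ CL ⊆ ZPP`, with the key open problem being the
relationship of `CL` to `P`."

## Why it is here

DEFINITION REQUEST of route `Summit.PneNP.PneNP.Theses.BorrowedMemory` (planner, 2026-08-17:
"a Literature definition … `CL` over `SpaceMachine` matching the inline lets verbatim (so the four
items can be restated by name)"), filed by a grounder while grounding its cruxes
`PolyTimeIsCatalytic` (stmt-PneNP-18880, `P ⊆ CL`) and `NPNotCatalytic` (stmt-PneNP-19091,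
`NP ⊄ CL`).  The membership predicate `InCL` below is that inline `let InCL` VERBATIM, so each
route item is `Iff.rfl`-equivalent to its restatement by name (checked in the grounder's evidence
file `CatalyticSpaceBridge.lean`, not here: Literature does not import Summits):
`PolyTimeIsCatalytic ↔ PNPWave0.P Bool ⊆ CL`, `NPNotCatalytic ↔ ∃ L ∈ PNPWave0.NP Bool, L ∉ CL`,
`CatalyticSanity ↔ (∅ ∈ CL ∧ univ ∈ CL)`, `LogspaceIsCatalytic ↔ LOGSPACE ⊆ CL`.

## The model (as typed by the route, over the tree's read-only-input stack machines)

A language `L ⊆ List Bool` is in `CL` iff there are an input-preserving stack machine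
`M : SpaceMachine Bool Bool` (`Space.lean`: Mathlib `TM2ComputableAux` with input stack `k₀`,
output stack `k₁`, left-of-head stack `kL`), two further distinguished stacks `kA ≠ kB` (the
catalytic tape, split at the head) whose alphabets are `Bool` (`eA`, `eB` — so no annotation trick
adds clean memory), a constant `c` and a polynomial `p`, such that for every input `x` and every
initial catalytic content `τ` with `|τ| = p(|x|)`, starting from `M.init x` with stack `kA` loaded
with `τ`: along every reachable configuration the input is preserved (`kL.reverse ++ k₀ = x`),
the clean work space (all stacks other than `k₀, kL, kA, kB`) is `≤ c·⌊log₂|x|⌋ + c` and the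
catalytic length `|kA| + |kB| ≤ p(|x|) + c`; and the run halts (`eval`) in a configuration whose
output stack reads `[true]`/`[false]` according to `x ∈ L`, with the catalytic tape RESTORED:
`kA = τ`, `kB = []`.  No time bound (CL, not CLP).

## Contents

* `InCL`, `CL`, `mem_CL_iff` — the definition (verbatim inline body) and its unfolding lemma.
* `BCKLS2014_CL_subset_ZPP` — NAMED FACT `CL ⊆ ZPP` (BCKLS 2014, abstract: "catalytic logspace is
  contained in ZPP"; the tree's `ZPP = RP ∩ coRP`, `ProbabilisticClasses.lean`).  Rendering
  caveat recorded in its docstring: the printed theorem is for multi-tape Turing machines with a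
  catalytic TAPE; the route's `SpaceMachine` stacks model the same resource (clean cells counted by
  total stack length, catalytic tape = two stacks split at the head), and the simulation between
  the two models is the usual tape/two-stack correspondence with constant-factor space overhead —
  absorbed by `c` — so the fact is stated for the route's model, which is the only one in the tree.
* NOT vendored as `Prop`s (gate policy: open problems live under `Summits/…` as cruxes, and
  provable statements are items, not facts): the OPEN problem `P ⊆ CL` — "the key open problem
  being the relationship of `CL` to `P`" (arXiv:2504.17412 p. 2; BCKLS 2014 §8), which is crux
  `PolyTimeIsCatalytic` (stmt-PneNP-18880) = `PNPWave0.P Bool ⊆ CL` by `Iff.rfl` — and the trivial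
  direction `LOGSPACE ⊆ CL` (BCKLS 2014 §1), which is the route's support `LogspaceIsCatalytic`.

Not here: `TC¹ ⊆ CL` (no uniform `TC¹` in the tree yet — `ConstantDepth.lean` has `NC k`, `TC0`
only), `CNL = CL` (Koucký–Mertz–Pyne–Sami 2025, arXiv:2504.08444), matching ∈ CL
(Agarwala–Mertz 2025); cite-only.
-/

namespace Literature.Computability.Complexity

open scoped BigOperators

/-- **Catalytic logspace decidability of a language** (BCKLS 2014, Def. of `CSPACE(s, c)` with
`s = O(log n)`, `c = n^{O(1)}`), over the tree's input-preserving stack machines — VERBATIM the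
inline `let InCL` of route `Summit.PneNP.PneNP.Theses.BorrowedMemory` (see module docstring for
the reading of each clause). [cite: BuhrmanEtAl2014, Def. 1 (catalytic Turing machine) / §2] -/
def InCL (L : Language Bool) : Prop :=
    ∃ (M : Literature.Computability.Complexity.SpaceMachine Bool Bool) (kA kB : M.tm.K) (eA : M.tm.Γ kA ≃ Bool) (_eB : M.tm.Γ kB ≃ Bool) (c : ℕ) (p : Polynomial ℕ), kA ≠ M.tm.k₀ ∧ kA ≠ M.tm.k₁ ∧ kA ≠ M.kL ∧ kB ≠ M.tm.k₀ ∧ kB ≠ M.tm.k₁ ∧ kB ≠ M.kL ∧ kA ≠ kB ∧ ∀ (x : List Bool) (τ : List Bool), τ.length = p.eval x.length → haveI := M.tm.kDecidableEq; haveI := M.tm.kFin; let start : M.tm.Cfg := ⟨(M.init x).l, (M.init x).var, Function.update (M.init x).stk kA (τ.map eA.symm)⟩; (∀ cfg : M.tm.Cfg, StateTransition.Reaches M.tm.step start cfg → ((cfg.stk M.kL).map M.leftAlphabet).reverse ++ (cfg.stk M.tm.k₀).map M.inputAlphabet = x ∧ (∑ k ∈ (((Finset.univ.erase M.tm.k₀).erase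 M.kL).erase kA).erase kB, (cfg.stk k).length) ≤ c * Nat.log 2 x.length + c ∧ (cfg.stk kA).length + (cfg.stk kB).length ≤ p.eval x.length + c) ∧ (∃ cfg : M.tm.Cfg, cfg ∈ StateTransition.eval M.tm.step start ∧ (x ∈ L → (cfg.stk M.tm.k₁).map M.outputAlphabet = [true]) ∧ (x ∉ L → (cfg.stk M.tm.k₁).map M.outputAlphabet = [false]) ∧ cfg.stk kA = τ.map eA.symm ∧ cfg.stk kB = [])

/-- **The class `CL` (catalytic logspace)** = `{L | InCL L}` (BCKLS 2014: `CL = CSPACE(O(log n), n^{O(1)})`).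
[cite: BuhrmanEtAl2014, §2] -/
def CL : Set (Language Bool) := {L | InCL L}

/-- Unfolding `CL` (definitional). [folklore] -/
theorem mem_CL_iff (L : Language Bool) : L ∈ CL ↔ InCL L := Iff.rfl

/-- NAMED FACT — **`CL ⊆ ZPP`** (Buhrman–Cleve–Koucký–Loff–Speelman, STOC 2014, abstract and the
upper-bound section: "catalytic logspace is contained in `ZPP`"; restated arXiv:2504.17412 p. 2,
arXiv:2504.08444 §1).  Idea in print: for all but a negligible fraction of initial contents `τ`
the catalytic machine halts within polynomially many steps (configurations cannot repeat across
different `τ` by reversibility/counting), so running it on a random `τ` with a clock gives a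
zero-error expected-polynomial-time algorithm.  Stated for the tree's stack-machine rendering of
`CL` (module docstring, rendering caveat) and the tree's `ZPP = RP ∩ coRP`
(`ProbabilisticClasses.lean`, Gill 1977 Thm 5.2(ii)).  Consequence used by the route's refuters:
`NP ⊆ CL → NP ⊆ ZPP`. [cite: BuhrmanEtAl2014, Thm 'CL ⊆ ZPP' (abstract; upper-bound section)] -/
def BCKLS2014_CL_subset_ZPP : Prop :=
  CL ⊆ ZPP

/-! ## Elementary relations (proved) -/

/-- Under `CL ⊆ ZPP`, the simulation half `P ⊆ CL` of route BorrowedMemory together with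
`NP ⊆ CL` would give `NP ⊆ ZPP`; contrapositively, `¬ (NP ⊆ ZPP)` implies the route's lower-bound
crux `NP ⊄ CL` (as the route header says: "X₂ sits below NP ⊄ ZPP"). [folklore] -/
theorem not_NP_subset_CL_of_not_NP_subset_ZPP (hZ : BCKLS2014_CL_subset_ZPP)
    (h : ¬ (PNPWave0.NP Bool ⊆ ZPP)) : ¬ (PNPWave0.NP Bool ⊆ CL) :=
  fun hNP => h (hNP.trans hZ)

/-- Witness form of the previous lemma, matching the shape of crux `NPNotCatalytic`
(`∃ L ∈ NP, ¬ InCL L`). [folklore] -/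
theorem exists_NP_not_InCL_of_not_NP_subset_ZPP (hZ : BCKLS2014_CL_subset_ZPP)
    (h : ¬ (PNPWave0.NP Bool ⊆ ZPP)) : ∃ L : Language Bool, L ∈ PNPWave0.NP Bool ∧ ¬ InCL L := by
  by_contra hc
  push Not at hc
  exact not_NP_subset_CL_of_not_NP_subset_ZPP hZ h (fun L hL => hc L hL)

end Literature.Computability.Complexity
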